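import Summits.Schanuel.Schanuel.Theorems.RootDecomp1KNW96Core07
import Summits.Schanuel.Schanuel.Theorems.RootDecomp1KNW96Gap

/-!
# RootDecomp1KNW96Core — lens 6, generation 24, node 2 «NW96 THEOREM 1 AT THE PRINTED CONSTANT 211, HYPOTHESIS-FREE» (RULE G26 (ii); CLAIM L2235, CHECKLIST G26-α = ACK L2236, NODE L2241 / REQUEST L2242, critic VERDICT L2243: CLEARED — THEOREM ×1 «`theorem …RootDecomp1KNW96Core.nesterenkoWaldschmidt1996_thm_1_holds : Literature.NumberTheory.Transcendental.NesterenkoWaldschmidt1996_thm_1` by proof»; AUDIT G22 CLOSED IN FULL; RULE G27; lens-6 tally THEOREM ×9 + CELL ×3 + AUDIT ×1) — continuation (RootDecomp1KNW96Core13): §B-211 parameters of design R-211 + §C-211 the error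

(lens-6 g24 HOME kernel K = HOME/decomp-schanuel-lens-6/g24b/NW96Params211.lean 79da3955…, 727 l, imports EXACTLY tree `…RootDecomp1KNW96Core07` + `…RootDecomp1KNW96Gap`; P NW96Params211Probe.lean d04e389f… rc 0. K-sha → part map of census g19 (three lens-6 kernels compete for Core numbers; allocation of VERDICT L2243 kept): RatExpSlot 65615678… §7/§8 = Core08/09 · Thm 5(1) b14a307c… = Core10–12 · THIS K 79da3955… = `RootDecomp1KNW96Core13`–`14` (727 l split for the 400-line cap): 13 = §B-211 the parameters of design R-211 (`params211_floors`, counting (2.1) `params211_counts`, `params211_L`: L ∈ (207Ψ, 208Ψ], T+1 < 20.8DVW) + §C-211 the error (`eps_facts_211`: X ≥ 211Ψℓ with 3Ψℓ room, `params_small_211`); 14 = §D-211 the budget (`lb_le_211`, `Tside_211`, `group1_211`…`group4_211` with certified 29.7 + 25 + 24.5 + 19.2 (+log 2) = 98.4 Ψℓ < 103.5 = 207/2, `row_lt_211`) + §E-211 `paramsOK_211 : ParamsOK 211` (scoped `maxHeartbeats 1000000` as in K and tree Core07) + the headline block: `nw1996MainR_211 : NW1996MainR 211`, `nesterenkoWaldschmidt1996_thm_1_holds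 : NesterenkoWaldschmidt1996_thm_1` (via tree `RootDecomp1KNW96Gap.thm_1_iff_mainR`), `nw1996MainR_of_ge (hc : 211 ≤ c) : NW1996MainR c` (tree `NW1996MainR.mono`).
DESIGN SENTENCE OF RECORD (VERDICT L2243, must be kept): the printed CONSTANT 211 is vindicated by a DIFFERENT parameter design R-211 (L-targeted T with L = (T+1)(2T₁+1) ∈ (207Ψ, 208Ψ], H = ⌊Wℓ/4⌋, S = ⌊24UV⌋, S₁ = ⌊4.7DW+½⌋, T₁ = ⌊5U+½⌋, ε = E^{−211Ψ}), NOT by print's parameters — the g22 audit's certified finding «Lemma 6's parameter box AS PRINTED does not satisfy the main inequality over ℤ-data» (`nw1996_lemma6_asPrinted_false_int`, RootDecomp1KNW96Gap02) STANDS; tree `nw1996MainR_400` (Core07) becomes a corollary. PORT EDITS: the file-wide `set_option linter.dupNamespace false` dropped; statements and proofs verbatim (all decls `_211`-suffixed, no def in K). `--supports stmt-Schanuel-33364`; no census credit carried; rung 0 — nothing here proves Schanuel. CONSEQUENCE OF RECORD (×0, census schedule): the `(hNW : NesterenkoWaldschmidt1996_thm_1)` binders in the tree are dischargeable BY NAM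E.)
-/

noncomputable section

open Finset

namespace Summit.Schanuel.Schanuel.Theorems.RootDecomp1KNW96Core

open Literature.NumberTheory.Transcendental

section Params211

open Real

section Params211B

/-! ### B-211. The parameters of design R-211 (floors), the counting conditions (2.1), the size of `L` -/

/-- **The floor bounds of design R-211**: `T₁ = ⌊5U + ½⌋`, `S₁ = ⌊4.7DW + ½⌋`, `H = ⌊Wℓ/4⌋`, `S = ⌊24UV⌋`,
`T + 1 = ⌊208Ψ/(2T₁+1)⌋` (`Ψ = DUVW`), together with `207Ψ < L = (T+1)(2T₁+1) ≤ 208Ψ` and `T + 1 < 20.8 DVW`.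
[cite: NesterenkoWaldschmidt1996, §6 (6.1); design R-211 (decomp-schanuel lens 6, g24)] -/
theorem params211_floors {D U V W ℓ : ℝ} (hD : 1 ≤ D) (hU : 1 ≤ U) (hV : 6 ≤ V) (hW : 2 ≤ W) (hℓ : 1 ≤ ℓ)
    {T₁ S₁ H S Tp : ℕ} (hT₁ : T₁ = ⌊5 * U + 1 / 2⌋₊) (hS₁ : S₁ = ⌊47 / 10 * D * W + 1 / 2⌋₊)
    (hH : H = ⌊W * ℓ / 4⌋₊) (hS : S = ⌊24 * U * V⌋₊)
    (hTp : Tp = ⌊208 * (D * U * V * W) / (2 * (T₁ : ℝ) + 1)⌋₊) :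
    ((T₁ : ℝ) ≤ 5 * U + 1 / 2 ∧ 5 * U + 1 / 2 - 1 < (T₁ : ℝ)) ∧
    ((S₁ : ℝ) ≤ 47 / 10 * D * W + 1 / 2 ∧ 47 / 10 * D * W + 1 / 2 - 1 < (S₁ : ℝ)) ∧
    ((H : ℝ) ≤ W * ℓ / 4 ∧ W * ℓ / 4 - 1 < (H : ℝ)) ∧
    ((S : ℝ) ≤ 24 * U * V ∧ 24 * U * V - 1 < (S : ℝ)) ∧
    ((Tp : ℝ) * (2 * (T₁ : ℝ) + 1) ≤ 208 * (D * U * V * W) ∧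
      207 * (D * U * V * W) < (Tp : ℝ) * (2 * (T₁ : ℝ) + 1) ∧
      (Tp : ℝ) < 104 / 5 * (D * V * W) ∧ 2 ≤ Tp) := by
  have hU0 : 0 ≤ U := by linarith
  have hV0 : 0 ≤ V := by linarith
  have hW0 : 0 ≤ W := by linarith
  have hD0 : 0 ≤ D := by linarith
  have hℓ0 : 0 ≤ ℓ := by linarith
  have hT₁f : ((T₁ : ℝ) ≤ 5 * U + 1 / 2 ∧ 5 * U + 1 / 2 - 1 < (T₁ : ℝ)) := by
    rw [hT₁]; exact NWPi.floor_facts (by positivity)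
  have hΨ0 : 0 ≤ D * U * V * W := by positivity
  have ht0 : 0 < 2 * (T₁ : ℝ) + 1 := by positivity
  have hTpf : ((Tp : ℝ) ≤ 208 * (D * U * V * W) / (2 * (T₁ : ℝ) + 1) ∧
      208 * (D * U * V * W) / (2 * (T₁ : ℝ) + 1) - 1 < (Tp : ℝ)) := by
    rw [hTp]; exact NWPi.floor_facts (by positivity)
  refine ⟨hT₁f, ?_, ?_, ?_, ?_⟩
  · rw [hS₁]; exact NWPi.floor_facts (by positivity)
  · rw [hH]; exact NWPi.floor_facts (by positivity)
  · rw [hS]; exact NWPi.floor_facts (by positivity)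
  · obtain ⟨hT₁le, hT₁gt⟩ := hT₁f
    obtain ⟨hTple, hTpgt⟩ := hTpf
    have h1 : (Tp : ℝ) * (2 * (T₁ : ℝ) + 1) ≤ 208 * (D * U * V * W) := by
      rw [le_div_iff₀ ht0] at hTple; exact hTple
    have h2 : 208 * (D * U * V * W) - (2 * (T₁ : ℝ) + 1) < (Tp : ℝ) * (2 * (T₁ : ℝ) + 1) := by
      have := mul_lt_mul_of_pos_right hTpgt ht0
      rwa [sub_mul, div_mul_cancel₀ _ ht0.ne', one_mul] at this
    -- `2T₁ + 1 ≤ 10U + 2 ≤ 12U ≤ Ψ` (`DVW ≥ 12`)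
    have hDVW12 : 12 ≤ D * V * W := by
      have h1' : 1 * 6 ≤ D * V := mul_le_mul hD hV (by norm_num) hD0
      have := mul_le_mul h1' hW (by norm_num) (by positivity)
      linarith
    have hUΨ : 12 * U ≤ D * U * V * W := by
      have := mul_le_mul_of_nonneg_left hDVW12 hU0; linarith
    have ht12 : 2 * (T₁ : ℝ) + 1 ≤ 12 * U := by linarith
    have h3 : 207 * (D * U * V * W) < (Tp : ℝ) * (2 * (T₁ : ℝ) + 1) := by linarith
    -- `Tp ≤ 208Ψ/(2T₁+1) < 208Ψ/(10U) = 20.8 DVW`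
    have ht10 : 10 * U < 2 * (T₁ : ℝ) + 1 := by linarith
    have h4 : (Tp : ℝ) < 104 / 5 * (D * V * W) := by
      by_contra hcon
      rw [not_lt] at hcon
      have h5 : 104 / 5 * (D * V * W) * (10 * U) < (Tp : ℝ) * (2 * (T₁ : ℝ) + 1) := by
        calc 104 / 5 * (D * V * W) * (10 * U) < 104 / 5 * (D * V * W) * (2 * (T₁ : ℝ) + 1) :=
              mul_lt_mul_of_pos_left ht10 (by positivity)
          _ ≤ (Tp : ℝ) * (2 * (T₁ : ℝ) + 1) := mul_le_mul_of_nonneg_right hcon ht0.le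
      have e : 104 / 5 * (D * V * W) * (10 * U) = 208 * (D * U * V * W) := by ring
      linarith
    have h5 : (2 : ℝ) ≤ Tp := by
      -- `Tp (2T₁+1) > 207Ψ ≥ 207 · 12 U` and `2T₁+1 ≤ 12U`
      by_contra hcon
      rw [not_le] at hcon
      have : (Tp : ℝ) * (2 * (T₁ : ℝ) + 1) ≤ 2 * (12 * U) := by
        have := mul_le_mul hcon.le ht12 ht0.le (by norm_num)
        linarith
      nlinarith
    have h5' : 2 ≤ Tp := by exact_mod_cast h5
    exact ⟨h1, h3, h4, h5'⟩

/-- **The counting conditions (2.1) and positivity for design R-211**: `H, T₁, S₁, S ≥ 1`, `2T₁ ≤ S + 1`,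
`(2T₁+1)T < (S+1−2T₁)(2S₁+1)` — since `(2T₁+1)T < L ≤ 208Ψ ≤ 225.6Ψ − 94DUW − 9.4DW ≤ (24UV − 10U − 1)·9.4DW`.
[cite: NesterenkoWaldschmidt1996, §6 a), (2.1); design R-211] -/
theorem params211_counts {D U V W ℓ : ℝ} (hD : 1 ≤ D) (hU : 1 ≤ U) (hV : 6 ≤ V) (hW : 2 ≤ W) (hℓ : 1 ≤ ℓ)
    (hWℓ12 : 12 ≤ W * ℓ)
    {T₁ S₁ H S T : ℕ} (hT₁le : (T₁ : ℝ) ≤ 5 * U + 1 / 2) (hT₁gt : 5 * U + 1 / 2 - 1 < (T₁ : ℝ))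
    (hS₁gt : 47 / 10 * D * W + 1 / 2 - 1 < (S₁ : ℝ)) (hHgt : W * ℓ / 4 - 1 < (H : ℝ))
    (hSgt : 24 * U * V - 1 < (S : ℝ)) (hL : ((T : ℝ) + 1) * (2 * (T₁ : ℝ) + 1) ≤ 208 * (D * U * V * W)) :
    (1 ≤ H ∧ 1 ≤ T₁ ∧ 1 ≤ S₁ ∧ 1 ≤ S) ∧ 2 * T₁ ≤ S + 1 ∧
      (2 * T₁ + 1) * T < (S + 1 - 2 * T₁) * (2 * S₁ + 1) := by
  have hU0 : 0 ≤ U := by linarith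
  have hD0 : 0 ≤ D := by linarith
  have hW0 : 0 ≤ W := by linarith
  have hWℓ : 2 * 1 ≤ W * ℓ := mul_le_mul hW hℓ (by norm_num) hW0
  have hDW : 1 * 2 ≤ D * W := mul_le_mul hD hW (by norm_num) hD0
  have hUV : 1 * 6 ≤ U * V := mul_le_mul hU hV (by norm_num) hU0
  have h1 : 1 ≤ H := by
    have h : ((1 : ℕ) : ℝ) ≤ H := by rw [Nat.cast_one]; linarith
    exact Nat.cast_le.mp h
  have h2 : 1 ≤ T₁ := by
    have h : ((1 : ℕ) : ℝ) ≤ T₁ := by rw [Nat.cast_one]; linarith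
    exact Nat.cast_le.mp h
  have h3 : 1 ≤ S₁ := by
    have h : ((1 : ℕ) : ℝ) ≤ S₁ := by rw [Nat.cast_one]; nlinarith
    exact Nat.cast_le.mp h
  have hUV' : 24 * U * 6 ≤ 24 * U * V := mul_le_mul_of_nonneg_left hV (by linarith)
  have h4 : 1 ≤ S := by
    have h : ((1 : ℕ) : ℝ) ≤ S := by rw [Nat.cast_one]; linarith
    exact Nat.cast_le.mp h
  have h5r : (2 : ℝ) * T₁ < S + 1 := by linarith
  have h5 : 2 * T₁ ≤ S + 1 := by
    have h : ((2 * T₁ : ℕ) : ℝ) < ((S + 1 : ℕ) : ℝ) := by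
      rw [Nat.cast_mul, Nat.cast_add, Nat.cast_two, Nat.cast_one]; exact h5r
    exact (Nat.cast_lt.mp h).le
  refine ⟨⟨h1, h2, h3, h4⟩, h5, ?_⟩
  -- the count in `ℝ`, `Ψ = DUVW`
  have hΨ0 : 0 ≤ D * U * V * W := by positivity
  have hB : 6 * (D * U * W) ≤ D * U * V * W := by
    have := mul_le_mul_of_nonneg_left hV (by positivity : 0 ≤ D * U * W); linarith
  have hC : D * W ≤ D * U * W := by
    have := mul_le_mul_of_nonneg_left hU (by positivity : 0 ≤ D * W); linarith
  have ht0 : 0 < 2 * (T₁ : ℝ) + 1 := by positivity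
  have hlhs : ((2 * T₁ + 1 : ℕ) : ℝ) * T < 208 * (D * U * V * W) := by
    push_cast
    have hb : (0 : ℝ) ≤ T := Nat.cast_nonneg _
    have e : ((T : ℝ) + 1) * (2 * (T₁ : ℝ) + 1) = (2 * (T₁ : ℝ) + 1) * T + (2 * (T₁ : ℝ) + 1) := by ring
    linarith
  have hrhs : 1128 / 5 * (D * U * V * W) - 94 * (D * U * W) - 47 / 5 * (D * W) ≤
      ((S + 1 - 2 * T₁ : ℕ) : ℝ) * ((2 * S₁ + 1 : ℕ) : ℝ) := by
    rw [Nat.cast_sub h5]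
    push_cast
    have ha : 24 * U * V - 10 * U - 1 ≤ (S : ℝ) + 1 - 2 * T₁ := by linarith
    have ha0 : 0 ≤ 24 * U * V - 10 * U - 1 := by nlinarith
    have hb : 47 / 5 * D * W ≤ 2 * (S₁ : ℝ) + 1 := by linarith
    have hc : (24 * U * V - 10 * U - 1) * (47 / 5 * D * W) ≤ ((S : ℝ) + 1 - 2 * T₁) * (2 * S₁ + 1) :=
      mul_le_mul ha hb (by positivity) (by linarith)
    have e : (24 * U * V - 10 * U - 1) * (47 / 5 * D * W) =
        1128 / 5 * (D * U * V * W) - 94 * (D * U * W) - 47 / 5 * (D * W) := by ring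
    linarith
  have hmid : 208 * (D * U * V * W) ≤
      1128 / 5 * (D * U * V * W) - 94 * (D * U * W) - 47 / 5 * (D * W) := by linarith
  have key : (((2 * T₁ + 1) * T : ℕ) : ℝ) < (((S + 1 - 2 * T₁) * (2 * S₁ + 1) : ℕ) : ℝ) := by
    rw [Nat.cast_mul, Nat.cast_mul]
    exact lt_of_lt_of_le hlhs (hmid.trans hrhs)
  exact Nat.cast_lt.mp key

/-- **The size of `L` and the width bound for design R-211**: `L = (T+1)(2T₁+1)` (as given), `2m ≤ L S₁(T₁+½)`
for `m = S₁(T+1)T₁(T₁+1)`, `N = T₁S₁ ≤ 8.5Ψ` (indeed `≤ 4.54Ψ`) and `S ≤ 12.5Ψ` (indeed `≤ 12Ψ`).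
[cite: NesterenkoWaldschmidt1996, §6 (6.4); design R-211] -/
theorem params211_L {D U V W : ℝ} (hD : 1 ≤ D) (hU : 1 ≤ U) (hV : 6 ≤ V) (hW : 2 ≤ W)
    {T₁ S₁ S T L m : ℕ} (hT₁le : (T₁ : ℝ) ≤ 5 * U + 1 / 2) (hS₁le : (S₁ : ℝ) ≤ 47 / 10 * D * W + 1 / 2)
    (hSle : (S : ℝ) ≤ 24 * U * V) (hL : L = (T + 1) * (2 * T₁ + 1))
    (hm : m = S₁ * (T + 1) * (T₁ * (T₁ + 1))) :
    (L : ℝ) = ((T : ℝ) + 1) * (2 * (T₁ : ℝ) + 1) ∧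
      2 * (m : ℝ) ≤ (L : ℝ) * ((S₁ : ℝ) * ((T₁ : ℝ) + 1 / 2)) ∧
      ((T₁ * S₁ : ℕ) : ℝ) ≤ 8.5 * (D * U * V * W) ∧ (S : ℝ) ≤ 12.5 * (D * U * V * W) ∧
      (S : ℝ) ≤ 12 * (D * U * V * W) := by
  have hU0 : 0 ≤ U := by linarith
  have hD0 : 0 ≤ D := by linarith
  have hW0 : 0 ≤ W := by linarith
  have hV0 : 0 ≤ V := by linarith
  have hDW : 1 * 2 ≤ D * W := mul_le_mul hD hW (by norm_num) hD0
  have hUV : 1 * 6 ≤ U * V := mul_le_mul hU hV (by norm_num) hU0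
  have hLr : (L : ℝ) = ((T : ℝ) + 1) * (2 * T₁ + 1) := by rw [hL]; push_cast; ring
  have hmr : (m : ℝ) = (S₁ : ℝ) * ((T : ℝ) + 1) * ((T₁ : ℝ) * ((T₁ : ℝ) + 1)) := by
    rw [hm]; push_cast; ring
  have hΨ0 : 0 ≤ D * U * V * W := by positivity
  have hT₁0 : (0 : ℝ) ≤ T₁ := Nat.cast_nonneg _
  have hS₁0 : (0 : ℝ) ≤ S₁ := Nat.cast_nonneg _
  have hT0 : (0 : ℝ) ≤ T := Nat.cast_nonneg _
  have hS12 : (S : ℝ) ≤ 12 * (D * U * V * W) := by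
    have h3 : 2 * (U * V) ≤ D * U * V * W := by
      have := mul_le_mul_of_nonneg_left hDW (by positivity : 0 ≤ U * V); linarith
    linarith
  refine ⟨hLr, ?_, ?_, by linarith, hS12⟩
  · have h1 : 2 * ((T₁ : ℝ) * ((T₁ : ℝ) + 1)) ≤ (2 * (T₁ : ℝ) + 1) * ((T₁ : ℝ) + 1 / 2) := by nlinarith
    have h2 : 0 ≤ (S₁ : ℝ) * ((T : ℝ) + 1) := by positivity
    have h3 := mul_le_mul_of_nonneg_left h1 h2
    have e1 : 2 * (m : ℝ) = (S₁ : ℝ) * ((T : ℝ) + 1) * (2 * ((T₁ : ℝ) * ((T₁ : ℝ) + 1))) := by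
      rw [hmr]; ring
    have e2 : (L : ℝ) * ((S₁ : ℝ) * ((T₁ : ℝ) + 1 / 2)) =
        (S₁ : ℝ) * ((T : ℝ) + 1) * ((2 * (T₁ : ℝ) + 1) * ((T₁ : ℝ) + 1 / 2)) := by
      rw [hLr]; ring
    rw [e1, e2]; exact h3
  · push_cast
    have h1 : (T₁ : ℝ) * S₁ ≤ (5 * U + 1 / 2) * (47 / 10 * D * W + 1 / 2) :=
      mul_le_mul hT₁le hS₁le hS₁0 (by positivity)
    have h2 : (5 * U + 1 / 2) * (47 / 10 * D * W + 1 / 2) ≤ (11 / 2 * U) * (99 / 20 * (D * W)) := by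
      apply mul_le_mul <;> linarith [hDW]
    have h3 : 6 * (D * U * W) ≤ D * U * V * W := by
      have := mul_le_mul_of_nonneg_left hV (by positivity : 0 ≤ D * U * W); linarith
    have e : (11 / 2 * U) * (99 / 20 * (D * W)) = 1089 / 40 * (D * U * W) := by ring
    linarith

end Params211B

section Params211C

/-! ### C-211. The error `ε = exp(−X)`, `X ≥ 211Ψℓ` (verbatim the tree's `eps_facts` / `params_small` with
`400 ↦ 211`, `397 ↦ 208`; the proofs use only `X ≥ 17.5Ψℓ` resp. the room `X − Lℓ ≥ 3Ψℓ`) -/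

/-- **The error is tiny** (design R-211). With `Ψ ≥ 12`, `ℓ ≥ 1`, `X ≥ 211Ψℓ`, `0 ≤ r`, `2Er ≤ Vℓ`, `2V ≤ Ψ`,
`1 ≤ N ≤ 8.5Ψ`: `ε e^r (2N+3) ≤ 1` (`ε = exp(−X)`), hence `ε ≤ 1`, `ε < e^{−r}`, and for
`B = e^r(1 + 1/(2N+2))`: `e^r + ε ≤ B`, `(e^{−r} − ε)⁻¹ ≤ B`, `0 < B`, `0 ≤ log B ≤ r + 1/(2N+2)`.
[cite: NesterenkoWaldschmidt1996, §6 b); design R-211] -/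
theorem eps_facts_211 {P ℓ X r E V N : ℝ} (hP : 12 ≤ P) (hℓ : 1 ≤ ℓ) (hX : 211 * P * ℓ ≤ X) (hr : 0 ≤ r)
    (hE : 2.718 ≤ E) (hVr : 2 * E * r ≤ V * ℓ) (hVP : 2 * V ≤ P) (hN0 : 1 ≤ N) (hN : N ≤ 8.5 * P) :
    exp (-X) * exp r * (2 * N + 3) ≤ 1 ∧ exp (-X) ≤ 1 ∧ exp (-X) < exp (-r) ∧
    exp r + exp (-X) ≤ exp r * (1 + 1 / (2 * N + 2)) ∧
    (exp (-r) - exp (-X))⁻¹ ≤ exp r * (1 + 1 / (2 * N + 2)) ∧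
    (0 < exp r * (1 + 1 / (2 * N + 2)) ∧ 0 ≤ log (exp r * (1 + 1 / (2 * N + 2))) ∧
      log (exp r * (1 + 1 / (2 * N + 2))) ≤ r + 1 / (2 * N + 2)) := by
  have hPℓ : 12 ≤ P * ℓ := by nlinarith
  have hVℓ : V * ℓ ≤ P / 2 * ℓ := mul_le_mul_of_nonneg_right (by linarith) (by linarith)
  have hrE : r ≤ E * r := le_mul_of_one_le_left hr (by linarith)
  have hr4 : r ≤ P * ℓ / 4 := by linarith
  have h23 : 0 < 2 * N + 3 := by linarith
  have hlog23 : log (2 * N + 3) ≤ 2 * N + 3 - 1 := Real.log_le_sub_one_of_pos h23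
  have hN' : 2 * N + 3 ≤ 69 / 4 * (P * ℓ) := by nlinarith
  have hkey : exp (-X) * exp r * (2 * N + 3) ≤ 1 := by
    calc exp (-X) * exp r * (2 * N + 3) = exp (-X + r + log (2 * N + 3)) := by
          rw [Real.exp_add, Real.exp_add, Real.exp_log h23]
      _ ≤ exp 0 := Real.exp_le_exp.mpr (by linarith)
      _ = 1 := Real.exp_zero
  have hε1 : exp (-X) ≤ 1 := by
    rw [← Real.exp_zero]; exact Real.exp_le_exp.mpr (by linarith)
  have hε2 : exp (-X) < exp (-r) := Real.exp_lt_exp.mpr (by linarith)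
  have her1 : 1 ≤ exp r := Real.one_le_exp hr
  have hε0 : 0 < exp (-X) := Real.exp_pos _
  have h22 : 0 < 2 * N + 2 := by linarith
  set B := exp r * (1 + 1 / (2 * N + 2)) with hBdef
  have hB0 : 0 < B := by positivity
  have hc4 : exp r + exp (-X) ≤ B := by
    have h1 : exp (-X) * (2 * N + 2) ≤ exp r := by
      have h2 : exp (-X) * (2 * N + 2) ≤ exp (-X) * exp r * (2 * N + 3) := by
        have h3 : exp (-X) * (2 * N + 2) ≤ exp (-X) * (2 * N + 3) := by nlinarith
        have h4 : exp (-X) * (2 * N + 3) ≤ exp (-X) * (2 * N + 3) * exp r :=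
          le_mul_of_one_le_right (by positivity) her1
        nlinarith
      linarith
    have h2 : exp (-X) ≤ exp r / (2 * N + 2) := by rw [le_div_iff₀ h22]; exact h1
    have e : B = exp r + exp r / (2 * N + 2) := by rw [hBdef]; ring
    rw [e]; linarith
  have hc5 : (exp (-r) - exp (-X))⁻¹ ≤ B := by
    have ha : 0 < exp (-r) - exp (-X) := by linarith
    apply inv_le_of_inv_le₀ hB0
    have h1 : exp (-X) * (2 * N + 3) ≤ exp (-r) := by
      have h2 : exp (-X) * (2 * N + 3) = exp (-X) * exp r * (2 * N + 3) * exp (-r) := by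
        have : exp r * exp (-r) = 1 := by rw [← Real.exp_add, add_neg_cancel, Real.exp_zero]
        calc exp (-X) * (2 * N + 3) = exp (-X) * (2 * N + 3) * (exp r * exp (-r)) := by rw [this, mul_one]
          _ = _ := by ring
      rw [h2]
      have h3 := mul_le_mul_of_nonneg_right hkey (Real.exp_pos (-r)).le
      linarith
    have hBinv : B⁻¹ = exp (-r) * ((2 * N + 2) / (2 * N + 3)) := by
      rw [hBdef, mul_inv, Real.exp_neg]
      congr 1
      rw [inv_eq_iff_eq_inv, inv_div]
      field_simp
      ring
    rw [hBinv]
    have h4 : exp (-r) * ((2 * N + 2) / (2 * N + 3)) = exp (-r) - exp (-r) / (2 * N + 3) := by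
      field_simp; ring
    rw [h4]
    have h5 : exp (-X) ≤ exp (-r) / (2 * N + 3) := by rw [le_div_iff₀ h23]; exact h1
    linarith
  have hlogB : log B = r + log (1 + 1 / (2 * N + 2)) := by
    rw [hBdef, Real.log_mul (Real.exp_pos r).ne' (by positivity), Real.log_exp]
  have hlog1 : log (1 + 1 / (2 * N + 2)) ≤ 1 / (2 * N + 2) := by
    have := Real.log_le_sub_one_of_pos (by positivity : (0 : ℝ) < 1 + 1 / (2 * N + 2)); linarith
  have hB1 : 1 ≤ B := by
    rw [hBdef]
    have : (1 : ℝ) ≤ 1 + 1 / (2 * N + 2) := by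
      have : (0 : ℝ) ≤ 1 / (2 * N + 2) := by positivity
      linarith
    nlinarith
  exact ⟨hkey, hε1, hε2, hc4, hc5, hB0, Real.log_nonneg hB1, by rw [hlogB]; linarith⟩

/-- **The perturbation majorant** (the `hMp` conjunct) for design R-211: with `(S + N)ε` in place of the
perturbation, `log B ≤ r + 1/(2N+2)`, `R ≥ 1`, `E ≥ 2.718`, `X ≥ 211Ψℓ ≥ Lℓ + 3Ψℓ`, `S ≤ 12.5Ψ`, `N ≤ 8.5Ψ`,
`L ≤ 208Ψ`: `𝔓₀ · R^S B^{N+1} (S+N) ε · E^L ≤ exp M`. [cite: NesterenkoWaldschmidt1996, §6 b); design R-211] -/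
theorem params_small_211 {S T T₁ S₁ H L : ℕ} {E R B r X P ℓ : ℝ} (hS : 1 ≤ S) (hT₁ : 1 ≤ T₁) (hS₁ : 1 ≤ S₁)
    (hH : 1 ≤ H) (hE : 2.718 ≤ E) (hℓ : ℓ = log E) (hℓ1 : 1 ≤ ℓ) (hP : 12 ≤ P) (hX : 211 * P * ℓ ≤ X)
    (hr : 0 ≤ r) (hR : 1 ≤ R) (hB0 : 0 < B) (hlogB : log B ≤ r + 1 / (2 * ((T₁ * S₁ : ℕ) : ℝ) + 2))
    (hSP : (S : ℝ) ≤ 12.5 * P) (hNP : ((T₁ * S₁ : ℕ) : ℝ) ≤ 8.5 * P) (hLP : (L : ℝ) ≤ 208 * P) :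
    (S : ℝ) ^ S * exp ((T : ℝ) + H) * (1 + (S₁ : ℝ) / H) ^ T * (T₁ : ℝ) ^ S *
        (R ^ S * B ^ (T₁ * S₁ + 1) * (((S : ℝ) + ((T₁ * S₁ : ℕ) : ℝ)) * exp (-X))) * E ^ L ≤
      exp ((S : ℝ) * log S + ((T : ℝ) + H) + T * log (1 + E * S₁ / H) + S * log (R * T₁) +
        r * T₁ * (E * S₁)) := by
  have hS0 : (0 : ℝ) < S := by exact_mod_cast hS
  have hT₁0 : (0 : ℝ) < T₁ := by exact_mod_cast hT₁
  have hT₁1 : (1 : ℝ) ≤ T₁ := by exact_mod_cast hT₁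
  have hS₁1 : (1 : ℝ) ≤ S₁ := by exact_mod_cast hS₁
  have hH0 : (0 : ℝ) < H := by exact_mod_cast hH
  have hE0 : 0 < E := by linarith
  have hR0 : 0 < R := by linarith
  set N : ℝ := ((T₁ * S₁ : ℕ) : ℝ) with hNdef
  have hNr : N = (T₁ : ℝ) * S₁ := by rw [hNdef]; push_cast; ring
  have hN1 : 1 ≤ N := by rw [hNr]; nlinarith
  have hSN : 0 < (S : ℝ) + N := by linarith
  have h1 : (0 : ℝ) < 1 + (S₁ : ℝ) / H := by positivity
  have hE' : (0 : ℝ) < 1 + E * S₁ / H := by positivity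
  -- write the left side as one exponential
  have hlhs : (S : ℝ) ^ S * exp ((T : ℝ) + H) * (1 + (S₁ : ℝ) / H) ^ T * (T₁ : ℝ) ^ S *
        (R ^ S * B ^ (T₁ * S₁ + 1) * (((S : ℝ) + N) * exp (-X))) * E ^ L =
      exp ((S : ℝ) * log S + ((T : ℝ) + H) + T * log (1 + (S₁ : ℝ) / H) + S * log T₁ +
        (S * log R + ((T₁ * S₁ + 1 : ℕ) : ℝ) * log B + (log ((S : ℝ) + N) + -X)) + L * log E) := by
    rw [pow_eq_exp_mul_log hS0, pow_eq_exp_mul_log h1, pow_eq_exp_mul_log hT₁0, pow_eq_exp_mul_log hR0,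
      pow_eq_exp_mul_log hB0, pow_eq_exp_mul_log hE0, ← Real.exp_log hSN]
    simp only [← Real.exp_add, Real.log_exp]
  rw [hlhs, Real.exp_le_exp]
  -- compare the exponents
  have hlogmono : log (1 + (S₁ : ℝ) / H) ≤ log (1 + E * S₁ / H) := by
    apply Real.log_le_log h1
    have : (S₁ : ℝ) / H ≤ E * S₁ / H := by
      rw [mul_div_assoc]; exact le_mul_of_one_le_left (by positivity) (by linarith)
    linarith
  have hT0 : (0 : ℝ) ≤ T := Nat.cast_nonneg _
  have hA : (T : ℝ) * log (1 + (S₁ : ℝ) / H) ≤ T * log (1 + E * S₁ / H) :=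
    mul_le_mul_of_nonneg_left hlogmono hT0
  have hRT : log (R * T₁) = log R + log T₁ := Real.log_mul hR0.ne' hT₁0.ne'
  have hNcast : ((T₁ * S₁ + 1 : ℕ) : ℝ) = N + 1 := by rw [hNdef]; push_cast; ring
  have hBb : (N + 1) * log B ≤ (N + 1) * r + 1 / 2 := by
    have h2 : (N + 1) * log B ≤ (N + 1) * (r + 1 / (2 * N + 2)) :=
      mul_le_mul_of_nonneg_left hlogB (by linarith)
    have e : (N + 1) * (r + 1 / (2 * N + 2)) = (N + 1) * r + 1 / 2 := by
      have h22 : 2 * N + 2 ≠ 0 := by positivity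
      field_simp
    linarith
  have hC : (N + 1) * r ≤ r * T₁ * (E * S₁) := by
    have e : r * T₁ * (E * S₁) = (N * E) * r := by rw [hNr]; ring
    rw [e]
    have : N + 1 ≤ N * E := by nlinarith
    exact mul_le_mul_of_nonneg_right this hr
  have hPℓ : 12 ≤ P * ℓ := by
    have := mul_le_mul hP hℓ1 zero_le_one (by linarith); linarith
  have hSNle : (S : ℝ) + N ≤ 21 * (P * ℓ) := by
    have : P ≤ P * ℓ := le_mul_of_one_le_right (by linarith) hℓ1
    linarith
  have hlogSN : log ((S : ℝ) + N) ≤ P * ℓ + 6.77 := by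
    have h2 : log ((S : ℝ) + N) ≤ log (21 * (P * ℓ)) := Real.log_le_log hSN hSNle
    rw [Real.log_mul (by norm_num) (by positivity)] at h2
    have h3 : log 21 ≤ 0.37 * 21 := log_le_mul (by norm_num)
    have h4 : log (P * ℓ) ≤ P * ℓ - 1 := Real.log_le_sub_one_of_pos (by positivity)
    linarith
  have hLℓ : (L : ℝ) * log E ≤ 208 * P * ℓ := by
    rw [← hℓ]
    have := mul_le_mul_of_nonneg_right hLP (by linarith : (0 : ℝ) ≤ ℓ)
    linarith
  rw [hNcast, hRT]
  linarith [hA, hBb, hC, hlogSN, hLℓ, hX, hPℓ]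

end Params211C

end Params211

end Summit.Schanuel.Schanuel.Theorems.RootDecomp1KNW96Core

end
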